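import Summits.Ventures.HSemireg.WedgeHankelPlaneAnnihilator
import Summits.Ventures.HSemireg.WedgeHankelTwoFiniteNodesImage

/-!
# Venture HSemireg — TRANSPORT OF ANNIHILATORS: `Ann_j(g·W) = g·Ann_j(W)` for every automorphism induced from the generators (the top coefficient is
# scaled by a non-zero constant), and THE IMAGE OF A TWO-NODE CLASS AT `(λ, ∞)` / `(λ, μ)` IN EVERY DEGREE `k′ ≥ P + P′ + 1`

HONEST FRAMING. Part of the Lean index of the computation cell `pub-hsemireg` (seat p10 gen 17, Sunday typer «UNIFORM-IN-n»).
Finite-dimensional EXTERIOR ALGEBRA over a field ONLY: no variety, no cohomology theory, no sheaf, no Ext group, no semiregularity map;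
nothing here says that HC / HC_CM / HC_AV holds; no Literature fact is declared or used.  Custodian versions as in `WedgeHankelSiegelIdeal` (1/3) and
`WedgeKernelDuality`; the dictionary (`plane(a,b) ↔ H^b(⋀^a T)`; the frames `{x_a + λ y_a}`; images of `⌟v`) is QUOTED, never asserted.

WHAT IS IN THE TREE.  Gen 6 `WedgeBasisFree` (`mapEquiv g`, `map_exteriorPower`); E5/E7/F1 (`Φs λ`, `Ψs`, `Ls c`, `Gs λ μ` and their transports of `Kr`, `V`, `SI_k`,
`coSiegel`: `Kr_mapEquiv`, `V_mapEquiv`, `map_Φs_coSiegel`, `map_Ψs_coSiegel`); E1 (`Ann`, `V_w_eq_Ann`); E9 `Kr_w_expMul_add_top` and F1 `Kr_w_two_finite_nodes` (the two-node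
KERNEL laws at `(λ, ∞)` and `(λ, μ)`, hypothesis `k + P + P′ + 1 ≤ n` only); G1 `WedgeHankelPlaneAnnihilator` (`Ann_xyRich`, `V_w_of_two_orders_eq` at `(0, ∞)`); F8 (the
two-node images in the range `P + P′ + 2 ≤ min(k′+1, n+1−k′)`).  THIS FILE (namespace `Summit.Ventures.HSemireg.Wedge.KernelDuality` continued; imports G1, F8):
* §83 THE TOP COEFFICIENT UNDER `mapEquiv g`: a top-degree class is `τ(y)·E_univ` (`eq_topCoeff_smul_B_univ`); **`topCoeff_mapEquiv`: `τ(mapEquiv g x) = τ(mapEquiv g E_univ) · τ(x)`**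
  (degrees are preserved, and `τ` sees only the top degree) with `τ(mapEquiv g E_univ) ≠ 0` (`topCoeff_mapEquiv_B_univ_ne_zero`).
* §84 **`Ann_map_mapEquiv`: `Ann_j(W.map (mapEquiv g)) = (Ann_j W).map (mapEquiv g)`** for EVERY linear automorphism `g` of the generators and every subspace `W`; instances
  `Ann_map_Φs`, `Ann_map_Ψs`, `Ann_map_Ls`, `Ann_map_Gs`; with F4b/G1: **`Ann_map_Φs_xRich`** (`Ann_j(Φs λ xRich(k,P)) = Φs λ xRich(j, n−P−1)`), **`Ann_map_Φs_xyRich`**, **`Ann_map_Gs_xyRich`**.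
* §85 `map_Ls_coSiegel`, `map_Gs_coSiegel` (the co-Siegel space is fixed by `Ls`, `Gs`), and THE TWO-NODE IMAGES IN EVERY DEGREE `k′` with `P + P′ + 1 ≤ k′`, `k + k′ = n`:
  **`V_w_expMul_add_top_eq`** (nodes `λ`, `∞`): `V(univ, w_n(expMul λ q₁ + s), k′) = coSiegel(k′+n) ⊓ Φs λ (xRich(k′+n, n−P−1) ⊔ yRich(k′+n, n−P′−1))`;
  **`V_w_two_finite_nodes_eq'`** (nodes `λ ≠ μ`): `V(univ, w_n(expMul λ q₁ + expMul μ q₂), k′) = coSiegel(k′+n) ⊓ Gs λ μ (xRich(k′+n, n−P−1) ⊔ yRich(k′+n, n−P′−1))` — E1's duality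
  on E9's / F1's kernel laws in the mirror degree; no upper bound `P + P′ + 2 ≤ n + 1 − k′` (F8's split names need it); the simple-node cases `V_w_exp_add_point_eq`,
  `V_w_exp_add_exp_eq` (`P = P′ = 0`, every degree `1 ≤ k′ ≤ n`).
NOT typed here: annihilators of frame-changed DIVISOR kernels with ≥ 3 nodes (F2b's intersections: `Ann` of an `iInf` is the `iSup` of the `Ann`s by E1 `Ann_inf`, pairwise);
anything Ext-side.  Class side only; new names only.
-/

open Module

namespace Summit.Ventures.HSemireg.Wedge.KernelDuality

open Summit.Ventures.HSemireg.Wedge Summit.Ventures.HSemireg.Wedge.Kunneth Summit.Ventures.HSemireg.Wedge.Hankel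
  Summit.Ventures.HSemireg.Wedge.HankelSiegel Summit.Ventures.HSemireg.Wedge.HankelSiegelIdeal Summit.Ventures.HSemireg.Wedge.KunnethKernel
  Summit.Ventures.HSemireg.Wedge.HankelSecant Summit.Ventures.HSemireg.Wedge.HankelFrameChange Summit.Ventures.HSemireg.Wedge.BasisFree

variable (K : Type*) [Field K] {n : ℕ}

/-! ## §83. The top coefficient under an automorphism induced from the generators -/

section TopCoeff

variable {I : Type*} [LinearOrder I] [Fintype I]

/-- the top coefficient vanishes on every homogeneous class of degree `≠ |I|`. -/
lemma topCoeff_eq_zero_of_mem_Hom_of_ne {d : ℕ} (hd : d ≠ Fintype.card I) {x : HT K I} (hx : x ∈ Hom K I Finset.univ d) : topCoeff K x = 0 := by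
  rw [topCoeff_apply]
  refine coord_eq_zero_of_mem_Hom K hx ?_
  rintro ⟨-, h⟩
  exact hd (by rw [← h, Finset.card_univ])

/-- **a top-degree class is a multiple of the volume monomial: `y = τ(y) • E_univ`** for `y ∈ Hom(univ, |I|)`. -/
lemma eq_topCoeff_smul_B_univ {y : HT K I} (hy : y ∈ Hom K I Finset.univ (Fintype.card I)) : y = topCoeff K y • B K I Finset.univ := by
  apply (B K I).repr.injective
  ext s
  rw [map_smul, Basis.repr_self, Finsupp.smul_apply, Finsupp.single_apply, smul_eq_mul]
  by_cases hs : s = Finset.univ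
  · subst hs
    rw [if_pos rfl, mul_one, topCoeff_apply, Basis.coord_apply]
  · rw [if_neg (fun h => hs h.symm), mul_zero, ← Basis.coord_apply]
    exact coord_eq_zero_of_mem_Hom K hy (by rintro ⟨-, h⟩; exact hs (Finset.eq_univ_of_card s h))

end TopCoeff

/-- **`τ(mapEquiv g x) = τ(mapEquiv g E_univ) · τ(x)`**: an automorphism of `⋀(K^{2n})` induced by a linear automorphism `g` of the generators preserves degrees, so the top
coefficient of `mapEquiv g x` only sees the `E_univ`-component of `x`, scaled by the constant `τ(mapEquiv g E_univ)` (the determinant of `g`; its value is never used). -/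
theorem topCoeff_mapEquiv (g : (In n → K) ≃ₗ[K] (In n → K)) (x : HT K (In n)) :
    topCoeff K (mapEquiv K g x) = topCoeff K (mapEquiv K g (B K (In n) Finset.univ)) * topCoeff K x := by
  conv_lhs => rw [← (B K (In n)).sum_repr x]
  rw [map_sum, map_sum, Finset.sum_eq_single Finset.univ]
  · rw [map_smul, map_smul, smul_eq_mul, mul_comm, topCoeff_apply K x, Basis.coord_apply]
  · intro s _ hs
    have hcard : s.card ≠ Fintype.card (In n) := fun h => hs (Finset.eq_univ_of_card s h)
    have hmem : mapEquiv K g (B K (In n) s) ∈ Hom K (In n) Finset.univ s.card := by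
      rw [Hom_univ_eq_exteriorPower]
      exact mapEquiv_mem_exteriorPower K g (by rw [← Hom_univ_eq_exteriorPower]; exact B_mem_Hom K (Finset.subset_univ s) rfl)
    rw [map_smul, map_smul, smul_eq_mul, topCoeff_eq_zero_of_mem_Hom_of_ne K hcard hmem, mul_zero]
  · intro h; exact absurd (Finset.mem_univ _) h

/-- **the scaling constant is non-zero**: `τ(mapEquiv g E_univ) ≠ 0` (`mapEquiv g E_univ` is a non-zero top-degree class, hence a non-zero multiple of `E_univ`). -/
theorem topCoeff_mapEquiv_B_univ_ne_zero (g : (In n → K) ≃ₗ[K] (In n → K)) : topCoeff K (mapEquiv K g (B K (In n) Finset.univ)) ≠ 0 := by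
  intro h0
  have hmem : mapEquiv K g (B K (In n) Finset.univ) ∈ Hom K (In n) Finset.univ (Fintype.card (In n)) := by
    rw [Hom_univ_eq_exteriorPower]
    exact mapEquiv_mem_exteriorPower K g (by rw [← Hom_univ_eq_exteriorPower]; exact B_mem_Hom K subset_rfl (by rw [Finset.card_univ]))
  have h1 := eq_topCoeff_smul_B_univ K hmem
  rw [h0, zero_smul] at h1
  exact (B K (In n)).ne_zero Finset.univ ((mapEquiv K g).injective (h1.trans (map_zero _).symm))

/-! ## §84. Annihilators are transported -/

/-- **ANNIHILATORS ARE TRANSPORTED: `Ann_j(mapEquiv g W) = mapEquiv g (Ann_j W)`** for every linear automorphism `g` of the generators and every subspace `W` — `mapEquiv g`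
preserves degrees and products and scales the top coefficient by a non-zero constant. -/
theorem Ann_map_mapEquiv (g : (In n → K) ≃ₗ[K] (In n → K)) (j : ℕ) (W : Submodule K (HT K (In n))) :
    Ann K j (W.map (mapEquiv K g).toLinearMap) = (Ann K j W).map (mapEquiv K g).toLinearMap := by
  have hc := topCoeff_mapEquiv_B_univ_ne_zero K g
  ext θ
  constructor
  · intro hθ
    obtain ⟨hθj, h0⟩ := mem_Ann.mp hθ
    have hθ' : θ ∈ (Hom K (In n) Finset.univ j).map (mapEquiv K g).toLinearMap := by
      rwa [Hom_univ_eq_exteriorPower, map_exteriorPower, ← Hom_univ_eq_exteriorPower]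
    obtain ⟨θ', hθ'j, rfl⟩ := hθ'
    refine ⟨θ', mem_Ann.mpr ⟨hθ'j, fun v hv => ?_⟩, rfl⟩
    have h1 := h0 _ (Submodule.mem_map_of_mem (f := (mapEquiv K g).toLinearMap) hv)
    rw [AlgEquiv.toLinearMap_apply, AlgEquiv.toLinearMap_apply, ← map_mul, topCoeff_mapEquiv] at h1
    exact (mul_eq_zero.mp h1).resolve_left hc
  · rintro ⟨θ', hθ', rfl⟩
    obtain ⟨hθ'j, h0⟩ := mem_Ann.mp hθ'
    refine mem_Ann.mpr ⟨?_, fun v hv => ?_⟩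
    · rw [Hom_univ_eq_exteriorPower] at hθ'j ⊢
      exact mapEquiv_mem_exteriorPower K g hθ'j
    · obtain ⟨v', hv', rfl⟩ := hv
      rw [AlgEquiv.toLinearMap_apply, AlgEquiv.toLinearMap_apply, ← map_mul, topCoeff_mapEquiv, h0 v' hv', mul_zero]

/-- instance: **the frame change, `Ann_j(Φs λ W) = Φs λ (Ann_j W)`.** -/
theorem Ann_map_Φs (lam : K) (j : ℕ) (W : Submodule K (HT K (In n))) :
    Ann K j (W.map (Φs K (n := n) lam).toLinearMap) = (Ann K j W).map (Φs K (n := n) lam).toLinearMap :=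
  Ann_map_mapEquiv K _ j W

/-- instance: **the swap, `Ann_j(Ψs W) = Ψs (Ann_j W)`.** -/
theorem Ann_map_Ψs (j : ℕ) (W : Submodule K (HT K (In n))) :
    Ann K j (W.map (Ψs K (n := n)).toLinearMap) = (Ann K j W).map (Ψs K (n := n)).toLinearMap :=
  Ann_map_mapEquiv K _ j W

/-- instance: **the lower shear, `Ann_j(Ls c W) = Ls c (Ann_j W)`.** -/
theorem Ann_map_Ls (c : K) (j : ℕ) (W : Submodule K (HT K (In n))) :
    Ann K j (W.map (Ls K (n := n) c).toLinearMap) = (Ann K j W).map (Ls K (n := n) c).toLinearMap := by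
  show Ann K j (W.map (((Ψs K (n := n)).trans (Φs K c)).trans (Ψs K)).toLinearMap) =
    (Ann K j W).map (((Ψs K (n := n)).trans (Φs K c)).trans (Ψs K)).toLinearMap
  rw [map_trans_eq, map_trans_eq, map_trans_eq, map_trans_eq, Ann_map_Ψs, Ann_map_Φs, Ann_map_Ψs]

/-- instance: **the two-frame automorphism, `Ann_j(Gs λ μ W) = Gs λ μ (Ann_j W)`.** -/
theorem Ann_map_Gs (lam mu : K) (j : ℕ) (W : Submodule K (HT K (In n))) :
    Ann K j (W.map (Gs K (n := n) lam mu).toLinearMap) = (Ann K j W).map (Gs K (n := n) lam mu).toLinearMap := by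
  show Ann K j (W.map ((Ls K (mu - lam)⁻¹).trans (Φs K lam)).toLinearMap) = (Ann K j W).map ((Ls K (mu - lam)⁻¹).trans (Φs K lam)).toLinearMap
  rw [map_trans_eq, map_trans_eq, Ann_map_Φs, Ann_map_Ls]

/-- **`Ann_j(Φs λ (xRich(k, P))) = Φs λ (xRich(j, n − P − 1))`** (`k + j = 2n`, `P < n`): a degree-`j` form pairs to zero with every form having more than `P` letters from the frame
`{x_a + λ y_a}` iff all its monomials IN THAT FRAME have at least `n − P` such letters. -/
theorem Ann_map_Φs_xRich (lam : K) {k j P : ℕ} (hkj : k + j = n + n) (hP : P < n) :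
    Ann K j ((xRich K n k P).map (Φs K (n := n) lam).toLinearMap) = (xRich K n j (n - P - 1)).map (Φs K (n := n) lam).toLinearMap := by
  rw [Ann_map_Φs, Ann_xRich K hkj hP]

/-- **`Ann_j(Φs λ (xyRich(k, P, P′))) = Φs λ (xRich(j, n−P−1) ⊔ yRich(j, n−P′−1))`** (`k + j = 2n`, `P, P′ < n`). -/
theorem Ann_map_Φs_xyRich (lam : K) {k j P P' : ℕ} (hkj : k + j = n + n) (hP : P < n) (hP' : P' < n) :
    Ann K j ((xyRich K n k P P').map (Φs K (n := n) lam).toLinearMap) =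
      (xRich K n j (n - P - 1) ⊔ yRich K n j (n - P' - 1)).map (Φs K (n := n) lam).toLinearMap := by
  rw [Ann_map_Φs, Ann_xyRich K hkj hP hP']

/-- **`Ann_j(Gs λ μ (xyRich(k, P, P′))) = Gs λ μ (xRich(j, n−P−1) ⊔ yRich(j, n−P′−1))`** (`k + j = 2n`, `P, P′ < n`). -/
theorem Ann_map_Gs_xyRich (lam mu : K) {k j P P' : ℕ} (hkj : k + j = n + n) (hP : P < n) (hP' : P' < n) :
    Ann K j ((xyRich K n k P P').map (Gs K (n := n) lam mu).toLinearMap) =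
      (xRich K n j (n - P - 1) ⊔ yRich K n j (n - P' - 1)).map (Gs K (n := n) lam mu).toLinearMap := by
  rw [Ann_map_Gs, Ann_xyRich K hkj hP hP']

/-! ## §85. The two-node images at `(λ, ∞)` and `(λ, μ)` in every degree `k′ ≥ P + P′ + 1` -/

/-- **the lower shear fixes the co-Siegel space: `Ls c (coSiegel(j)) = coSiegel(j)`.** -/
theorem map_Ls_coSiegel (c : K) (j : ℕ) : (coSiegel K n j).map (Ls K (n := n) c).toLinearMap = coSiegel K n j := by
  show (coSiegel K n j).map (((Ψs K (n := n)).trans (Φs K c)).trans (Ψs K)).toLinearMap = _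
  rw [map_trans_eq, map_trans_eq, map_Ψs_coSiegel, map_Φs_coSiegel, map_Ψs_coSiegel]

/-- **the two-frame automorphism fixes the co-Siegel space: `Gs λ μ (coSiegel(j)) = coSiegel(j)`.** -/
theorem map_Gs_coSiegel (lam mu : K) (j : ℕ) : (coSiegel K n j).map (Gs K (n := n) lam mu).toLinearMap = coSiegel K n j := by
  show (coSiegel K n j).map ((Ls K (mu - lam)⁻¹).trans (Φs K lam)).toLinearMap = _
  rw [map_trans_eq, map_Ls_coSiegel, map_Φs_coSiegel]

/-- **THE IMAGE OF A TWO-NODE CLASS AT `(λ, ∞)` IN EVERY DEGREE**: `q₁` supported on `[0, P]` with `q₁ P ≠ 0`, `s` vanishing below `n − P′` with `s (n−P′) ≠ 0`, `k + k′ = n` and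
`P + P′ + 1 ≤ k′` ⇒ **`V(univ, w_n(expMul λ q₁ + s), k′) = coSiegel(k′+n) ⊓ Φs λ (xRich(k′+n, n−P−1) ⊔ yRich(k′+n, n−P′−1))`** — E1's duality on E9's kernel law in the
mirror degree `k = n − k′`. -/
theorem V_w_expMul_add_top_eq (lam : K) {k k' P P' : ℕ} (hkk' : k + k' = n) (hPP' : P + P' + 1 ≤ k') {q₁ s : ℕ → K}
    (hq₁ : ∀ j, P < j → q₁ j = 0) (hq₁P : q₁ P ≠ 0) (hs : ∀ j, j < n - P' → s j = 0) (hsP : s (n - P') ≠ 0) :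
    V K (In n) Finset.univ (w K n n (fun j => expMul K lam q₁ j + s j)) k' =
      coSiegel K n (k' + n) ⊓ (xRich K n (k' + n) (n - P - 1) ⊔ yRich K n (k' + n) (n - P' - 1)).map (Φs K (n := n) lam).toLinearMap := by
  rw [V_w_eq_Ann K hkk', Kr_w_expMul_add_top K lam (by omega) hq₁ hq₁P hs hsP, Ann_sup, Ann_siegelIdeal K (by omega),
    Ann_map_Φs_xyRich K lam (by omega) (by omega) (by omega)]

/-- **THE IMAGE OF A TWO-NODE CLASS AT `(λ, μ)`, `λ ≠ μ`, IN EVERY DEGREE**: `q₁` of exact order `P`, `q₂` of exact order `P′`, `k + k′ = n`, `P + P′ + 1 ≤ k′` ⇒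
**`V(univ, w_n(expMul λ q₁ + expMul μ q₂), k′) = coSiegel(k′+n) ⊓ Gs λ μ (xRich(k′+n, n−P−1) ⊔ yRich(k′+n, n−P′−1))`** — E1's duality on F1's kernel law; F8's split name
`Gs λ μ ((coSiegel ⊓ xRich) ⊔ (coSiegel ⊓ yRich))` needs `P + P′ + 2 ≤ n + 1 − k′` as well. -/
theorem V_w_two_finite_nodes_eq' {lam mu : K} (h : lam ≠ mu) {k k' P P' : ℕ} (hkk' : k + k' = n) (hPP' : P + P' + 1 ≤ k') {q₁ q₂ : ℕ → K}
    (hq₁ : ∀ j, P < j → q₁ j = 0) (hq₁P : q₁ P ≠ 0) (hq₂ : ∀ j, P' < j → q₂ j = 0) (hq₂P : q₂ P' ≠ 0) :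
    V K (In n) Finset.univ (w K n n (fun j => expMul K lam q₁ j + expMul K mu q₂ j)) k' =
      coSiegel K n (k' + n) ⊓ (xRich K n (k' + n) (n - P - 1) ⊔ yRich K n (k' + n) (n - P' - 1)).map (Gs K (n := n) lam mu).toLinearMap := by
  rw [V_w_eq_Ann K hkk', Kr_w_two_finite_nodes K h (by omega) hq₁ hq₁P hq₂ hq₂P, Ann_sup, Ann_siegelIdeal K (by omega),
    Ann_map_Gs_xyRich K lam mu (by omega) (by omega) (by omega)]

/-- the split form is contained: `Gs λ μ ((coSiegel ⊓ xRich(k′+n, n−P−1)) ⊔ (coSiegel ⊓ yRich(k′+n, n−P′−1))) ≤ V(univ, w_n(expMul λ q₁ + expMul μ q₂), k′)` (`P + P′ + 1 ≤ k′`). -/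
theorem map_Gs_sup_inf_le_V_w {lam mu : K} (h : lam ≠ mu) {k k' P P' : ℕ} (hkk' : k + k' = n) (hPP' : P + P' + 1 ≤ k') {q₁ q₂ : ℕ → K}
    (hq₁ : ∀ j, P < j → q₁ j = 0) (hq₁P : q₁ P ≠ 0) (hq₂ : ∀ j, P' < j → q₂ j = 0) (hq₂P : q₂ P' ≠ 0) :
    ((coSiegel K n (k' + n) ⊓ xRich K n (k' + n) (n - P - 1)) ⊔ (coSiegel K n (k' + n) ⊓ yRich K n (k' + n) (n - P' - 1))).map
        (Gs K (n := n) lam mu).toLinearMap ≤ V K (In n) Finset.univ (w K n n (fun j => expMul K lam q₁ j + expMul K mu q₂ j)) k' := by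
  rw [V_w_two_finite_nodes_eq' K h hkk' hPP' hq₁ hq₁P hq₂ hq₂P]
  calc ((coSiegel K n (k' + n) ⊓ xRich K n (k' + n) (n - P - 1)) ⊔ (coSiegel K n (k' + n) ⊓ yRich K n (k' + n) (n - P' - 1))).map
        (Gs K (n := n) lam mu).toLinearMap
      ≤ (coSiegel K n (k' + n) ⊓ (xRich K n (k' + n) (n - P - 1) ⊔ yRich K n (k' + n) (n - P' - 1))).map (Gs K (n := n) lam mu).toLinearMap :=
        Submodule.map_mono (sup_le (inf_le_inf_left _ le_sup_left) (inf_le_inf_left _ le_sup_right))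
    _ = _ := by rw [Submodule.map_inf _ (Gs K (n := n) lam mu).injective, map_Gs_coSiegel]

/-- **THE PURE CLASS AT `λ` PLUS THE POINT** (`A, c ≠ 0`, `k + k′ = n`, `1 ≤ k′`): `V(univ, w_n(A λ^• + c·δ_n), k′) = coSiegel(k′+n) ⊓ Φs λ (xRich(k′+n, n−1) ⊔ yRich(k′+n, n−1))`. -/
theorem V_w_exp_add_point_eq (lam : K) {k k' : ℕ} (hkk' : k + k' = n) (hk' : 1 ≤ k') {A c : K} (hA : A ≠ 0) (hc : c ≠ 0) :
    V K (In n) Finset.univ (w K n n (fun j => A * lam ^ j + if j = n then c else 0)) k' =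
      coSiegel K n (k' + n) ⊓ (xRich K n (k' + n) (n - 1) ⊔ yRich K n (k' + n) (n - 1)).map (Φs K (n := n) lam).toLinearMap := by
  have e : (fun j => A * lam ^ j + if j = n then c else 0) = fun j => expMul K lam (fun i => if i = 0 then A else 0) j + (fun i => if i = n then c else 0) j := by
    funext j; rw [expMul_spike_zero]
  rw [e, V_w_expMul_add_top_eq K lam hkk' (P := 0) (P' := 0) (by omega) (fun j hj => if_neg (by omega)) (by rwa [if_pos rfl])
      (fun j hj => if_neg (by omega)) (by rw [Nat.sub_zero, if_pos rfl]; exact hc), Nat.sub_zero]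

/-- **TWO PURE CLASSES** (`λ ≠ μ`, `A, B ≠ 0`, `k + k′ = n`, `1 ≤ k′`): `V(univ, w_n(A λ^• + B μ^•), k′) = coSiegel(k′+n) ⊓ Gs λ μ (xRich(k′+n, n−1) ⊔ yRich(k′+n, n−1))`. -/
theorem V_w_exp_add_exp_eq {lam mu : K} (h : lam ≠ mu) {k k' : ℕ} (hkk' : k + k' = n) (hk' : 1 ≤ k') {A B : K} (hA : A ≠ 0) (hB : B ≠ 0) :
    V K (In n) Finset.univ (w K n n (fun j => A * lam ^ j + B * mu ^ j)) k' =
      coSiegel K n (k' + n) ⊓ (xRich K n (k' + n) (n - 1) ⊔ yRich K n (k' + n) (n - 1)).map (Gs K (n := n) lam mu).toLinearMap := by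
  have e : (fun j => A * lam ^ j + B * mu ^ j) =
      fun j => expMul K lam (fun i => if i = 0 then A else 0) j + expMul K mu (fun i => if i = 0 then B else 0) j := by
    funext j; rw [expMul_spike_zero, expMul_spike_zero]
  rw [e, V_w_two_finite_nodes_eq' K h hkk' (P := 0) (P' := 0) (by omega) (fun j hj => if_neg (by omega)) (by rwa [if_pos rfl])
      (fun j hj => if_neg (by omega)) (by rwa [if_pos rfl]), Nat.sub_zero]

end Summit.Ventures.HSemireg.Wedge.KernelDuality
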